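import Summits.CriticalPhenomena.SAWScalingLimit.Theorems.SAWLoopFugacityFlowSimpleSubseqLimitsStubPassage
import Literature.Probability.LatticeModels.PolylinePrefix
import Literature.Probability.Percolation.BoxCrossingProofs
import HarnessLib

/-!
# Prefix timing — support file for `stub_prefixTiming`
(line `slit-continuous-restriction` of the crux `SAWLoopFugacityFlow.SimpleSubseqLimits`,
stmt-CriticalPhenomena-4982; registered skeleton
`Summits/CriticalPhenomena/SAWScalingLimit/Cruxes/SimpleSubseqLimits/Lines/slit_continuous_restriction.lean`)

Dyadic parametrisation of the mesh polyline `latticeCurve γ = polyline (γ.support.map (meshPoint δ))`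
of a lattice SAW `γ` (`SimpleGraph.Walk.toCurve`, tree file `LatticeInterface.lean`): the polyline
`polyline (a :: l) = (polylineFrom a l).2` is built by ITERATED `Path.trans`
(`(segment a b).trans (polylineFrom b l')`) ending with the constant tail `Path.refl`, so the `k`-th
edge is traversed during `[1 - 2^{-k}, 1 - 2^{-(k+1)}]` and the tail rests at the last vertex on
`[1 - 2^{-|l|}, 1]`.

* `polylineFrom_apply_eq_getElem` / `polyline_apply_vertexTime` — the `k`-th vertex sits at the
  **vertex time** `1 - 2^{-k}`;
* `polylineFrom_apply_of_le` / `polyline_apply_of_vertexTime_le` — constant tail after the last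
  vertex time;
* `polylineFrom_apply_mem_segment` / `polyline_apply_mem_segment` — between consecutive vertex
  times the polyline lies on the closed segment joining the two vertices;
* `polyline_take_apply` — the polyline of the first `k + 1` vertices is the full polyline composed
  with `min · (1 - 2^{-k})` (prefix agreement `PolylinePrefix.polyline_eqOn_of_take_eq` up to the
  prefix time, constant afterwards);
* `stub_prefixTiming : PrefixTiming` — the registered stub (the four clauses for `latticeCurve γ`).

Adjacent sites of `ℤ²` have mesh points at distance `|δ|`: the tree's
`Literature.Probability.Percolation.dist_meshPoint_of_adj` (`BoxCrossingProofs.lean`).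

No named facts. Sources: F. Camia, C. M. Newman, Probab. Theory Related Fields 139 (2007), §2
(lattice paths as polygonal curves) [CamiaNewman2007].
-/

noncomputable section

open MeasureTheory Filter Topology Set Metric Function
open Literature.Probability.RandomPlanarGeometry Literature.Probability.RandomPlanarGeometry.SAW
open Literature.Probability.LatticeModels
open scoped ENNReal NNReal unitInterval

namespace Summit.CriticalPhenomena.SAWScalingLimit.Theorems.SimpleSubseqLimits.SlitRestriction.Timing

open Summit.CriticalPhenomena.SAWScalingLimit.Theorems.SimpleSubseqLimits.MarkedPointRevisit.Passage
  (latticeCurve)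

/-- The **dyadic vertex time** `1 - 2^{-k}`: the parameter at which the mesh polyline of a lattice walk
(`SimpleGraph.Walk.toCurve`, built by iterated `Path.trans`) sits at its `k`-th vertex
(`PolylinePrefix`). [folklore] -/
def vertexTime (k : ℕ) : I := ⟨1 - (1 / 2) ^ k, one_sub_half_pow_mem_unitInterval k⟩

/-- Vertex times increase. [folklore] -/
theorem vertexTime_mono {k l : ℕ} (h : k ≤ l) : vertexTime k ≤ vertexTime l := by
  change (1 : ℝ) - (1 / 2) ^ k ≤ 1 - (1 / 2) ^ l
  have := pow_le_pow_of_le_one (by norm_num : (0 : ℝ) ≤ 1 / 2) (by norm_num) h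
  linarith

/-- Vertex times are at most `1`. [folklore] -/
theorem vertexTime_le_one (k : ℕ) : vertexTime k ≤ 1 := by
  change (1 : ℝ) - (1 / 2) ^ k ≤ 1
  have : (0 : ℝ) ≤ (1 / 2) ^ k := by positivity
  linarith

/-- `1 - 2^{-(n+1)} ≤ 1/2` forces `n = 0`. [folklore] -/
theorem eq_zero_of_one_sub_half_pow_succ_le_half {n : ℕ}
    (h : (1 : ℝ) - (1 / 2) ^ (n + 1) ≤ 1 / 2) : n = 0 := by
  rcases n with _ | n
  · rfl
  · exfalso
    have h1 : (1 / 2 : ℝ) ^ (n + 1 + 1) ≤ 1 / 4 := by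
      rw [pow_succ, pow_succ]
      have : (1 / 2 : ℝ) ^ n ≤ 1 := pow_le_one₀ (by norm_num) (by norm_num)
      nlinarith
    linarith

/-- A path evaluated at a parameter of value `1` is at its target. [folklore] -/
theorem path_apply_of_coe_eq_one {X : Type*} [TopologicalSpace X] {x y : X} (p : Path x y) {s : I}
    (hs : (s : ℝ) = 1) : p s = y := by
  obtain rfl : s = 1 := Subtype.ext hs
  exact p.target

/-- A path evaluated at a parameter of value `0` is at its source. [folklore] -/
theorem path_apply_of_coe_eq_zero {X : Type*} [TopologicalSpace X] {x y : X} (p : Path x y) {s : I}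
    (hs : (s : ℝ) = 0) : p s = x := by
  obtain rfl : s = 0 := Subtype.ext hs
  exact p.source

/-! ## Dyadic timing of `polylineFrom` / `polyline` in a real topological vector space -/

section Polyline

variable {E : Type*} [AddCommGroup E] [Module ℝ E] [TopologicalSpace E] [ContinuousAdd E]
  [ContinuousSMul ℝ E]

/-- **Vertex times.** `polylineFrom a l` is at the `k`-th vertex of `a :: l` at the parameter
`1 - 2^{-k}` (`k ≤ |l|`; dyadic parametrisation of iterated `Path.trans`). [folklore] -/
theorem polylineFrom_apply_eq_getElem (a : E) (l : List E) {k : ℕ} (hk : k ≤ l.length) {t : I}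
    (ht : (t : ℝ) = 1 - (1 / 2) ^ k) :
    (polylineFrom a l).2 t = (a :: l)[k]'(by rw [List.length_cons]; omega) := by
  induction l generalizing a k t with
  | nil =>
    obtain rfl : k = 0 := Nat.le_zero.1 hk
    rw [path_apply_of_coe_eq_zero _ (by rw [ht]; norm_num)]
    rfl
  | cons b m ih =>
    rcases k with _ | k
    · rw [path_apply_of_coe_eq_zero _ (by rw [ht]; norm_num)]
      rfl
    · show ((Path.segment a b).trans (polylineFrom b m).2) t = _
      rw [Path.trans_apply, List.getElem_cons_succ]
      split_ifs with h
      · -- `t ≤ 1/2` forces `k = 0`, `t = 1/2`, and the value is `b`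
        obtain rfl : k = 0 := eq_zero_of_one_sub_half_pow_succ_le_half (ht.symm.trans_le h)
        rw [path_apply_of_coe_eq_one]
        · rfl
        · change 2 * (t : ℝ) = 1
          rw [ht]
          norm_num
      · refine ih b (by rw [List.length_cons] at hk; omega) ?_
        change 2 * (t : ℝ) - 1 = 1 - (1 / 2) ^ k
        rw [ht, pow_succ]
        ring

/-- **Constant tail.** After the last vertex time `1 - 2^{-|l|}` the path `polylineFrom a l` rests
at the last vertex `(a :: l).getLast`. [folklore] -/
theorem polylineFrom_apply_of_le (a : E) (l : List E) {t : I}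
    (ht : (1 : ℝ) - (1 / 2) ^ l.length ≤ t) :
    (polylineFrom a l).2 t = (a :: l).getLast (List.cons_ne_nil a l) := by
  induction l generalizing a t with
  | nil => rfl
  | cons b m ih =>
    show ((Path.segment a b).trans (polylineFrom b m).2) t = (a :: b :: m).getLast _
    rw [Path.trans_apply, List.getLast_cons (List.cons_ne_nil b m)]
    rw [List.length_cons] at ht
    split_ifs with h
    · -- `t ≤ 1/2` forces `m = []`, `t = 1/2`, and the value is `b`
      obtain rfl : m = [] :=
        List.eq_nil_of_length_eq_zero (eq_zero_of_one_sub_half_pow_succ_le_half (ht.trans h))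
      rw [path_apply_of_coe_eq_one]
      · rfl
      · change 2 * (t : ℝ) = 1
        norm_num at ht
        linarith
    · refine ih b ?_
      change (1 : ℝ) - (1 / 2) ^ m.length ≤ 2 * t - 1
      rw [pow_succ] at ht
      linarith

/-- **Edges.** Between the vertex times `1 - 2^{-k}` and `1 - 2^{-(k+1)}` (`k < |l|`) the path
`polylineFrom a l` runs along the closed segment from the `k`-th to the `(k+1)`-st vertex of
`a :: l`. [folklore] -/
theorem polylineFrom_apply_mem_segment (a : E) (l : List E) {k : ℕ} (hk : k < l.length) {t : I}
    (h₁ : (1 : ℝ) - (1 / 2) ^ k ≤ t) (h₂ : (t : ℝ) ≤ 1 - (1 / 2) ^ (k + 1)) :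
    (polylineFrom a l).2 t ∈ segment ℝ ((a :: l)[k]'(by rw [List.length_cons]; omega))
      ((a :: l)[k + 1]'(by rw [List.length_cons]; omega)) := by
  induction l generalizing a k t with
  | nil => exact absurd hk (Nat.not_lt_zero k)
  | cons b m ih =>
    show ((Path.segment a b).trans (polylineFrom b m).2) t ∈ _
    rw [Path.trans_apply]
    rcases k with _ | k
    · -- first edge: `t ≤ 1/2`, the value is a point of `segment a b`
      have h : (t : ℝ) ≤ 1 / 2 := by norm_num at h₂; exact h₂
      rw [dif_pos h]
      show (Path.segment a b) _ ∈ segment ℝ a b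
      rw [← Path.range_segment a b]
      exact Set.mem_range_self _
    · rw [List.getElem_cons_succ, List.getElem_cons_succ]
      split_ifs with h
      · -- `t ≤ 1/2` forces `k = 0`, `t = 1/2`, and the value is the left endpoint `b`
        obtain rfl : k = 0 := eq_zero_of_one_sub_half_pow_succ_le_half (h₁.trans h)
        rw [path_apply_of_coe_eq_one _ (by change 2 * (t : ℝ) = 1; norm_num at h₁; linarith),
          List.getElem_cons_zero]
        exact left_mem_segment ℝ b _
      · refine ih b (by rw [List.length_cons] at hk; omega) ?_ ?_
        · change (1 : ℝ) - (1 / 2) ^ k ≤ 2 * t - 1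
          rw [pow_succ] at h₁
          linarith
        · change 2 * (t : ℝ) - 1 ≤ 1 - (1 / 2) ^ (k + 1)
          rw [pow_succ] at h₂
          linarith

/-- `polyline` form of the vertex times: `polyline L` is at `L[k]` at the vertex time `1 - 2^{-k}`
(`k < |L|`). [folklore] -/
theorem polyline_apply_vertexTime {L : List E} {k : ℕ} (hk : k < L.length) :
    polyline L (vertexTime k) = L[k] := by
  cases L with
  | nil => simp at hk
  | cons a l =>
    exact polylineFrom_apply_eq_getElem a l (by rw [List.length_cons] at hk; omega) rfl

/-- `polyline` form of the constant tail: after the last vertex time `1 - 2^{-(|L| - 1)}` the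
polyline of a nonempty list rests at its last point. [folklore] -/
theorem polyline_apply_of_vertexTime_le {L : List E} (hL : L ≠ []) {t : I}
    (ht : vertexTime (L.length - 1) ≤ t) : polyline L t = L.getLast hL := by
  cases L with
  | nil => exact absurd rfl hL
  | cons a l =>
    refine polylineFrom_apply_of_le a l ?_
    have ht' : (1 : ℝ) - (1 / 2) ^ ((a :: l).length - 1) ≤ t := ht
    simpa only [List.length_cons, Nat.add_sub_cancel] using ht'

/-- `polyline` form of the edge clause: between the vertex times of `k` and `k + 1`
(`k + 1 < |L|`) the polyline lies on the closed segment `[L[k], L[k+1]]`. [folklore] -/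
theorem polyline_apply_mem_segment {L : List E} {k : ℕ} (hk : k + 1 < L.length) {t : I}
    (h₁ : vertexTime k ≤ t) (h₂ : t ≤ vertexTime (k + 1)) :
    polyline L t ∈ segment ℝ L[k] L[k + 1] := by
  cases L with
  | nil => simp at hk
  | cons a l =>
    exact polylineFrom_apply_mem_segment a l (by rw [List.length_cons] at hk; omega)
      (show ((vertexTime k : I) : ℝ) ≤ t from h₁) (show (t : ℝ) ≤ vertexTime (k + 1) from h₂)

/-- **Prefix polyline = full polyline stopped at the prefix time.** For `k + 1 ≤ |L|` the
polyline of the first `k + 1` points of `L` is `polyline L ∘ min · (1 - 2^{-k})`: the two agree up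
to the prefix time (`polyline_eqOn_of_take_eq`) and the prefix polyline is constant afterwards.
[folklore] -/
theorem polyline_take_apply {L : List E} {k : ℕ} (hk : k + 1 ≤ L.length) (t : I) :
    polyline (L.take (k + 1)) t = polyline L (min t (vertexTime k)) := by
  have hPlen : (L.take (k + 1)).length = k + 1 := by
    rw [List.length_take]
    omega
  have hne : L.take (k + 1) ≠ [] := List.ne_nil_of_length_eq_add_one hPlen
  have hagree : EqOn (polyline (L.take (k + 1))) (polyline L) (Iic (vertexTime k)) :=
    polyline_eqOn_of_take_eq (by rw [List.take_take, min_self]) hPlen.ge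
  have hconst : ∀ s : I, vertexTime k ≤ s →
      polyline (L.take (k + 1)) s = (L.take (k + 1)).getLast hne := fun s hs =>
    polyline_apply_of_vertexTime_le hne (by rw [hPlen, Nat.add_sub_cancel]; exact hs)
  rcases le_total t (vertexTime k) with ht | ht
  · rw [min_eq_left ht, hagree ht]
  · rw [min_eq_right ht, hconst t ht, ← hconst (vertexTime k) le_rfl]
    exact hagree Set.self_mem_Iic

end Polyline

/-! ## Mesh geometry -/

/-- A point of a closed segment is within the length of the segment of both endpoints.
[folklore] -/
theorem dist_le_of_mem_segment {p q z : ℂ} (hz : z ∈ segment ℝ p q) :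
    dist z p ≤ dist p q ∧ dist z q ≤ dist p q := by
  constructor
  · have hsub := (convex_closedBall p (dist p q)).segment_subset (mem_closedBall_self dist_nonneg)
      (by rw [mem_closedBall, dist_comm])
    exact hsub hz
  · have hsub := (convex_closedBall q (dist p q)).segment_subset (by rw [mem_closedBall])
      (mem_closedBall_self dist_nonneg)
    exact hsub hz

/-! ## The mesh polyline of a lattice SAW -/

section Walk

variable {Ω : Set ℂ} {δ : ℝ} {u v : Site 2}

/-- `latticeCurve γ` is the polyline of the list of mesh vertices (definitional). [folklore] -/
theorem latticeCurve_apply (γ : SAW.DomainSAW Ω δ u v) (t : I) :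
    latticeCurve γ t = polyline (γ.walk.support.map (meshPoint δ)) t := rfl

/-- The list of mesh vertices has `|γ| + 1` entries. [folklore] -/
theorem length_map_support (γ : SAW.DomainSAW Ω δ u v) :
    (γ.walk.support.map (meshPoint δ)).length = γ.walk.length + 1 := by
  rw [List.length_map, SimpleGraph.Walk.length_support]

/-- The `k`-th mesh vertex is the mesh point of the `k`-th vertex of the walk. [folklore] -/
theorem getElem_map_support (γ : SAW.DomainSAW Ω δ u v) {k : ℕ} (hk : k ≤ γ.walk.length) :
    (γ.walk.support.map (meshPoint δ))[k]'(by rw [length_map_support]; omega) =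
      meshPoint δ (γ.walk.getVert k) := by
  rw [List.getElem_map, SimpleGraph.Walk.getVert_eq_support_getElem _ hk]

/-- The last mesh vertex is the mesh point of the endpoint. [folklore] -/
theorem getLast_map_support (γ : SAW.DomainSAW Ω δ u v)
    (h : γ.walk.support.map (meshPoint δ) ≠ []) :
    (γ.walk.support.map (meshPoint δ)).getLast h = meshPoint δ v := by
  rw [List.getLast_map, SimpleGraph.Walk.getLast_support]

/-- **(a) Vertex times.** The mesh polyline sits at its `k`-th vertex at time `1 - 2^{-k}` (for
`k ≥ |γ|` this is the endpoint, inside the constant tail). [folklore] -/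
theorem latticeCurve_vertexTime (γ : SAW.DomainSAW Ω δ u v) (k : ℕ) :
    latticeCurve γ (vertexTime k) = meshPoint δ (γ.walk.getVert k) := by
  rw [latticeCurve_apply]
  rcases le_or_gt k γ.walk.length with hk | hk
  · rw [polyline_apply_vertexTime (by rw [length_map_support]; omega), getElem_map_support γ hk]
  · rw [SimpleGraph.Walk.getVert_of_length_le _ hk.le,
      polyline_apply_of_vertexTime_le (by simp) ?_, getLast_map_support]
    rw [length_map_support, Nat.add_sub_cancel]
    exact vertexTime_mono hk.le

/-- After the last vertex time the mesh polyline rests at the endpoint. [folklore] -/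
theorem latticeCurve_of_vertexTime_length_le (γ : SAW.DomainSAW Ω δ u v) {t : I}
    (ht : vertexTime γ.walk.length ≤ t) : latticeCurve γ t = meshPoint δ v := by
  rw [latticeCurve_apply, polyline_apply_of_vertexTime_le (by simp) ?_, getLast_map_support]
  rwa [length_map_support, Nat.add_sub_cancel]

/-- **(b) Endpoint.** The mesh polyline ends at the mesh point of the endpoint. [folklore] -/
theorem latticeCurve_one (γ : SAW.DomainSAW Ω δ u v) : latticeCurve γ 1 = meshPoint δ v :=
  latticeCurve_of_vertexTime_length_le γ (vertexTime_le_one _)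

/-- **(c) Edges.** Between two consecutive vertex times the mesh polyline stays within `|δ|` of both
vertices (it runs along the lattice edge joining them; in the constant tail both are the endpoint).
[folklore] -/
theorem dist_latticeCurve_le (γ : SAW.DomainSAW Ω δ u v) {t : I} {l : ℕ} (h₁ : vertexTime l ≤ t)
    (h₂ : t ≤ vertexTime (l + 1)) :
    dist (latticeCurve γ t) (meshPoint δ (γ.walk.getVert l)) ≤ |δ| ∧
      dist (latticeCurve γ t) (meshPoint δ (γ.walk.getVert (l + 1))) ≤ |δ| := by
  rcases lt_or_ge l γ.walk.length with hl | hl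
  · -- on the `l`-th lattice edge
    have hmem : latticeCurve γ t ∈
        segment ℝ (meshPoint δ (γ.walk.getVert l)) (meshPoint δ (γ.walk.getVert (l + 1))) := by
      have := polyline_apply_mem_segment (L := γ.walk.support.map (meshPoint δ)) (k := l)
        (by rw [length_map_support]; omega) h₁ h₂
      rwa [getElem_map_support γ hl.le, getElem_map_support γ hl] at this
    have hadj : (zdGraph 2).Adj (γ.walk.getVert l) (γ.walk.getVert (l + 1)) :=
      meshGraph_le_zdGraph Ω δ (discreteDomainGraph_le_meshGraph Ω δ (γ.walk.adj_getVert_succ hl))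
    have hd := dist_le_of_mem_segment hmem
    rw [Literature.Probability.Percolation.dist_meshPoint_of_adj hadj] at hd
    exact hd
  · -- in the constant tail: both vertices are the endpoint
    rw [latticeCurve_of_vertexTime_length_le γ ((vertexTime_mono hl).trans h₁),
      SimpleGraph.Walk.getVert_of_length_le _ hl,
      SimpleGraph.Walk.getVert_of_length_le _ (Nat.le_succ_of_le hl), dist_self]
    exact ⟨abs_nonneg δ, abs_nonneg δ⟩

/-- **(d) Prefix polylines.** The polyline of the prefix walk with `k + 1` vertices is the full
polyline composed with `min · (1 - 2^{-k})`. [folklore] -/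
theorem polyline_map_take_support (γ : SAW.DomainSAW Ω δ u v) {k : ℕ} (t : I)
    (hk : k ≤ γ.walk.length) :
    polyline ((γ.walk.support.take (k + 1)).map (meshPoint δ)) t =
      latticeCurve γ (min t (vertexTime k)) := by
  rw [List.map_take, latticeCurve_apply]
  exact polyline_take_apply (by rw [length_map_support]; omega) t

end Walk

/-! ## The registered stub -/

/-- **PREFIX TIMING** (helper statement of the transfer; dyadic parametrisation of the mesh polyline
`latticeCurve γ`, tree file `Literature…PolylinePrefix`): (a) the polyline sits at its `k`-th vertex
at time `1 - 2^{-k}` (for `k ≥ |γ|` this is the endpoint, inside the constant tail); (b) it ends at the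
endpoint; (c) between two consecutive vertex times it stays within `|δ|` of both vertices (it runs
along the lattice edge joining them); (d) the polyline of the prefix walk with `k + 1` vertices is the
full polyline composed with `min · (1 - 2^{-k})` (prefix agreement up to the prefix time, constant
afterwards). Registered stub statement of crux stmt-CriticalPhenomena-4982 (line
slit-continuous-restriction), body verbatim from the line skeleton
`Cruxes/SimpleSubseqLimits/Lines/slit_continuous_restriction.lean`; a helper statement of this line,
not a literature fact, hence untagged and declared here; proved below (`stub_prefixTiming`). -/
def PrefixTiming : Prop :=
  ∀ (Ω : Set ℂ) (δ : ℝ) (u v : Site 2) (γ : SAW.DomainSAW Ω δ u v),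
    (∀ k : ℕ, latticeCurve γ (vertexTime k) = meshPoint δ (γ.walk.getVert k)) ∧
    latticeCurve γ 1 = meshPoint δ v ∧
    (∀ (t : I) (l : ℕ), vertexTime l ≤ t → t ≤ vertexTime (l + 1) →
        dist (latticeCurve γ t) (meshPoint δ (γ.walk.getVert l)) ≤ |δ| ∧
        dist (latticeCurve γ t) (meshPoint δ (γ.walk.getVert (l + 1))) ≤ |δ|) ∧
    (∀ (k : ℕ) (t : I), k ≤ γ.length →
        polyline ((γ.walk.support.take (k + 1)).map (meshPoint δ)) t =
          latticeCurve γ (min t (vertexTime k)))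

/-- **stub 2b — PREFIX TIMING**: the four clauses of `PrefixTiming` hold for every lattice SAW
(`latticeCurve_vertexTime`, `latticeCurve_one`, `dist_latticeCurve_le`,
`polyline_map_take_support`). [folklore] -/
theorem stub_prefixTiming : PrefixTiming := fun _ _ _ _ γ =>
  ⟨latticeCurve_vertexTime γ, latticeCurve_one γ, fun _ _ h₁ h₂ => dist_latticeCurve_le γ h₁ h₂,
    fun _ t hk => polyline_map_take_support γ t hk⟩

end Summit.CriticalPhenomena.SAWScalingLimit.Theorems.SimpleSubseqLimits.SlitRestriction.Timing

end
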